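import Mathlib
import HarnessLib
import Summits.Ventures.LatticeQCDFlow.Scoring.ChainTimeAverage
import Summits.Ventures.LatticeQCDFlow.Scoring.RestartChainAutocorrelation
import Summits.Ventures.LatticeQCDFlow.Scoring.PathIMHAutocorrelation

/-!
# Certified error bars for the two non-equilibrium samplers of row 8: the restart chain inherits the
# prior sweep's Doeblin constant, the Metropolized switch the work floor's

HONEST FRAMING: exact (Metropolis-corrected) sampling algorithms for lattice gauge theory;
figures of merit are autocorrelation/cost numbers at stated couplings and volumes; no
continuum-physics claim.

Venture `LatticeQCDFlow` (cell pub-lqcd), topic `Scoring`; FANOUT row 8 (`s0-cpn-nemc`, GEN-12).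
NEW WORK of the cell, not a published result; no definition is introduced.  Compositions of the
bridge `Scoring/ChainTimeAverage.lean` (`variance_timeAverage_le_of_doeblin`: Doeblin by the
invariant law ⇒ `Var[(1/N) Σ f(X_i)] ≤ (2/ε − 1) Var f / N` for Mathlib's `Kernel.trajMeasure`) with
`Scoring/RestartChainAutocorrelation.lean` (the restart chain `K(x, ω) = κ₀ x ⊗ₘ κF` of evolutions
started from a prior chain) and `Scoring/PathIMHAutocorrelation.lean` (the Metropolized switch of a
Crooks pair, `pathIMH_doeblin`).

## Content

* **`restart_doeblin`** — a Doeblin constant of the PRIOR chain is one of the restart chain: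
  `κ₀(x, ·) ≥ ε π₀` ⇒ `K((x, ω), ·) ≥ ε (π₀ ⊗ₘ κF)` (the fresh record costs nothing);
* **`restart_variance_timeAverage_le`** — hence for every bounded measurable record observable `G`
  (a truncated Jarzynski weight, an end-point observable) and every `N ≥ 1`, along the restart chain
  started in `Π = π₀ ⊗ₘ κF`: `Var[(1/N) Σ_{i<N} G(x_i, ω_i)] ≤ (2/ε − 1) · Var_Π G / N` — the
  correlated-restart average has a certified error bar from the prior sweep's constant ALONE;
* **`pathIMH_variance_timeAverage_le`** — for the path-IMH chain of a Crooks pair with work floor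
  `W ≥ W_lo`, started in `P_R`: `Var[(1/N) Σ_{i<N} g(ω_i)] ≤ (2 e^{−W_lo} Z₀/Z₁ − 1) · Var_{P_R} g / N`
  (`= (2e^{ΔF − W_lo} − 1) Var g / N`) for every bounded measurable `g` on records.

NOT CLAIMED: any number of ours; unbounded weights; the ratio (self-normalised) estimator.
-/

noncomputable section

namespace Summit.Ventures.LatticeQCDFlow.Scoring

open MeasureTheory ProbabilityTheory Filter Finset Preorder Set
open Summit.Ventures.LatticeQCDFlow.Exactness Summit.Ventures.LatticeQCDFlow.Exactness.GeneralNCMC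
open scoped ENNReal

variable {Ω E : Type*} [MeasurableSpace Ω] [MeasurableSpace E]

/-! ### The restart chain -/

section Restart

variable {κ₀ : Kernel Ω Ω} [IsMarkovKernel κ₀] {κF : Kernel Ω E} [IsMarkovKernel κF]
  {π₀ : Measure Ω} [IsProbabilityMeasure π₀] {ε : ℝ≥0∞}

omit [IsProbabilityMeasure π₀] in
/-- **A Doeblin constant of the prior chain is one of the restart chain**:
`κ₀(x, ·) ≥ ε π₀` for all `x` gives `K((x, ω), ·) ≥ ε (π₀ ⊗ₘ κF)` for all `(x, ω)`. -/
theorem restart_doeblin [SFinite π₀]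
    (hmin : ∀ x {B : Set Ω}, MeasurableSet B → ε * π₀ B ≤ κ₀ x B) :
    ∀ p {S : Set (Ω × E)}, MeasurableSet S →
      ε * (π₀ ⊗ₘ κF) S ≤ ((Kernel.prodMkRight E κ₀) ⊗ₖ (Kernel.prodMkLeft (Ω × E) κF)) p S := by
  intro p S hS
  have hle : ε • π₀ ≤ κ₀ p.1 := by
    refine Measure.le_iff.2 fun B hB => ?_
    rw [Measure.smul_apply, smul_eq_mul]
    exact hmin p.1 hB
  rw [restart_apply, Measure.compProd_apply hS, Measure.compProd_apply hS, ← smul_eq_mul,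
    ← lintegral_smul_measure]
  exact lintegral_mono' hle le_rfl

/-- **Certified error bar for the correlated-restart average**: with a Doeblin constant `ε > 0` of
the prior chain by its invariant law `π₀`, every bounded measurable record observable `G` has, along
the restart chain started in `Π = π₀ ⊗ₘ κF` and for every `N ≥ 1`:
`Var[(1/N) Σ_{i<N} G(x_i, ω_i)] ≤ (2/ε − 1) · Var_Π G / N`. -/
theorem restart_variance_timeAverage_le (hπ₀ : Kernel.Invariant κ₀ π₀)
    (hmin : ∀ x {B : Set Ω}, MeasurableSet B → ε * π₀ B ≤ κ₀ x B) (hε0 : 0 < ε)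
    {G : Ω × E → ℝ} (hG : Measurable G) {C : ℝ} (hC : ∀ p, |G p| ≤ C) {N : ℕ} (hN : N ≠ 0) :
    Var[fun x : ℕ → Ω × E => (∑ i ∈ Finset.range N, G (x i)) / N;
        Kernel.trajMeasure (X := fun _ : ℕ => Ω × E) (π₀ ⊗ₘ κF)
          (fun m : ℕ => ((Kernel.prodMkRight E κ₀) ⊗ₖ (Kernel.prodMkLeft (Ω × E) κF)).comap
            (fun h : (i : ↥(Finset.Iic m)) → Ω × E => h ⟨m, Finset.mem_Iic.2 le_rfl⟩)
            (measurable_pi_apply _))]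
      ≤ (2 / ε.toReal - 1)
          * autocov ((Kernel.prodMkRight E κ₀) ⊗ₖ (Kernel.prodMkLeft (Ω × E) κF)) (π₀ ⊗ₘ κF)
              (fun p => G p - ∫ p', G p' ∂(π₀ ⊗ₘ κF)) 0 / N :=
  variance_timeAverage_le_of_doeblin (invariant_restart hπ₀)
    (fun p _ hS => restart_doeblin (κF := κF) hmin p hS) hε0 hG hC hN

end Restart

/-! ### The Metropolized switch (path-IMH of a Crooks pair) -/

section PathIMH

variable {ν₀ ν₁ : Measure Ω} [IsFiniteMeasure ν₀] [IsFiniteMeasure ν₁] {κF κR : Kernel Ω E}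
  [IsMarkovKernel κF] [IsMarkovKernel κR] {s e : E → Ω} {W : E → ℝ}

/-- **Certified error bar for the Metropolized switch**: for a Crooks pair with work floor
`W ≥ W_lo`, the path-IMH chain started in `P_R = fwdPathLaw ν₁ κR` has, for every bounded measurable
record observable `g` and every `N ≥ 1`:
`Var[(1/N) Σ_{i<N} g(ω_i)] ≤ (2 e^{−W_lo} Z₀/Z₁ − 1) · Var_{P_R} g / N`. -/
theorem pathIMH_variance_timeAverage_le (h0 : ν₀ univ ≠ 0) (h1 : ν₁ univ ≠ 0)
    (h : CrooksPair ν₀ ν₁ κF κR s e W) {Wlo : ℝ} (hlo : ∀ ω, Wlo ≤ W ω) {g : E → ℝ}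
    (hg : Measurable g) {C : ℝ} (hC : ∀ ω, |g ω| ≤ C) {N : ℕ} (hN : N ≠ 0) :
    haveI := isProbabilityMeasure_fwdPathLaw ν₀ h0 κF
    haveI : Fact (Measurable fun ω => Real.exp (-W ω)) :=
      ⟨Real.measurable_exp.comp h.measurable_W.neg⟩
    let K := indepMH (fwdPathLaw ν₀ κF) fun ω => Real.exp (-W ω)
    Var[fun x : ℕ → E => (∑ i ∈ Finset.range N, g (x i)) / N;
        Kernel.trajMeasure (X := fun _ : ℕ => E) (fwdPathLaw ν₁ κR)
          (fun m : ℕ => K.comap (fun hh : (i : ↥(Finset.Iic m)) → E => hh ⟨m, Finset.mem_Iic.2 le_rfl⟩)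
            (measurable_pi_apply _))]
      ≤ (2 * (Real.exp (-Wlo) * ((ν₀ univ).toReal / (ν₁ univ).toReal)) - 1)
          * autocov K (fwdPathLaw ν₁ κR) (fun ω => g ω - ∫ ω', g ω' ∂(fwdPathLaw ν₁ κR)) 0 / N := by
  intro K
  haveI := isProbabilityMeasure_fwdPathLaw ν₀ h0 κF
  haveI := isProbabilityMeasure_fwdPathLaw ν₁ h1 κR
  haveI : Fact (Measurable fun ω => Real.exp (-W ω)) := ⟨Real.measurable_exp.comp h.measurable_W.neg⟩
  haveI : IsMarkovKernel (indepMH (fwdPathLaw ν₀ κF) fun ω => Real.exp (-W ω)) := inferInstance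
  obtain ⟨hZ0, hZtop, hZr⟩ := massRatio_spec h0 h1
  have hε0 : 0 < (ν₀ univ)⁻¹ * ν₁ univ / ENNReal.ofReal (Real.exp (-Wlo)) :=
    ENNReal.div_pos hZ0 ENNReal.ofReal_ne_top
  have hv := variance_timeAverage_le_of_doeblin (κ := K) (pathIMH_invariant_revLaw h0 h1 h)
    (fun ω B hB => pathIMH_doeblin h0 h1 h hlo ω hB) hε0 hg hC hN
  have hconst : 2 / ((ν₀ univ)⁻¹ * ν₁ univ / ENNReal.ofReal (Real.exp (-Wlo))).toReal - 1
      = 2 * (Real.exp (-Wlo) * ((ν₀ univ).toReal / (ν₁ univ).toReal)) - 1 := by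
    have hν0 : (ν₀ univ).toReal ≠ 0 := ENNReal.toReal_ne_zero.2 ⟨h0, measure_ne_top ν₀ univ⟩
    have hν1 : (ν₁ univ).toReal ≠ 0 := ENNReal.toReal_ne_zero.2 ⟨h1, measure_ne_top ν₁ univ⟩
    rw [ENNReal.toReal_div, ENNReal.toReal_ofReal (Real.exp_pos _).le, hZr]
    field_simp
  rw [hconst] at hv
  exact hv

end PathIMH

end Summit.Ventures.LatticeQCDFlow.Scoring

end
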